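import Mathlib.Analysis.Matrix.Spectrum
import Mathlib.LinearAlgebra.Matrix.Nondegenerate
import Literature.LinearAlgebra.Matrix.RayleighQuotient
import HarnessLib

/-!
# Sign witnesses for a hermitian form: vectors with `x^*Ax > 0` / `< 0`, positive / negative eigenvalues,
# isotropic vectors of a non-degenerate form, and the `3 × 3` «indefinite ⇒ signature `(2,1)` or `(1,2)`»

Topic `Literature/LinearAlgebra/Matrix`, namespace `Literature.LinearAlgebra.Matrix`.  THEOREMS ONLY (kernel checked,
no `def`, no `sorry`, no instance, no notation), over `RCLike 𝕜`, on top of the tree's Rayleigh-quotient theorem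
★ `Literature.LinearAlgebra.Matrix.RayleighQuotient.re_form_le_sup_mul` ∕ `inf_mul_le_re_form` (Horn–Johnson Thm. 4.2.2 (c))
and Mathlib's spectral theorem for hermitian matrices (`Matrix.IsHermitian.eigenvalues`).

[HornJohnson2013] R. A. Horn, C. R. Johnson, *Matrix Analysis*, 2nd ed. (CUP 2013):
* §4.2, exercise after Thm. 4.2.2 (p. 304): for `x ≠ 0`, `α = x^*Ax / x^*x`, «there is at least one eigenvalue of `A` in
  `(−∞, α]` and at least one in `[α, ∞)`» — hence `x^*Ax > 0` for some `x` forces a positive eigenvalue and `x^*Ax < 0` a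
  negative one (`exists_eigenvalues_pos_of_re_form_pos`, `exists_eigenvalues_neg_of_re_form_neg`); for a `3 × 3` hermitian
  matrix taking both signs the number of positive eigenvalues is therefore `1` or `2` (`card_eigenvalues_pos_eq_one_or_two`).
* §4.1 (polarisation, p. 226 ff.): a NON-DEGENERATE hermitian form with a non-zero isotropic vector `v` (`v^*Av = 0`) takes both
  signs: pick `w` with `v^*Aw = 1`; then `(v + r w)^*A(v + r w) = 2r + r² · w^*Aw` for real `r`
  (`exists_re_form_pos_and_neg_of_isotropic`).
Small algebra used by arithmetic consumers (hermitian forms over CM fields seen at a complex embedding and at its conjugate):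
`form_add_smul` (expansion of `(x + s y)^*A(x + s y)`), `star_form_of_isHermitian` (`conj (x^*Ay) = y^*Ax`),
`form_mul_of_mulVec_eq_smul` (`v^*(AY)v = x · v^*Av` when `Yv = xv`), `form_map_starRingEnd` (`ū^* Ā ū = conj (u^*Au)`).
-/

noncomputable section

open Matrix Finset

namespace Literature.LinearAlgebra.Matrix

variable {𝕜 : Type*} [RCLike 𝕜] {n : Type*} [Fintype n]

/-! ## §1 Algebra of the form `x ↦ x^*Ay` -/

/-- Expansion `(x + s•y)^* A (x + s•y) = x^*Ax + s·x^*Ay + s̄·y^*Ax + s̄s·y^*Ay`. [cite: HornJohnson2013, §4.1 (p. 226)] -/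
theorem form_add_smul (A : Matrix n n 𝕜) (x y : n → 𝕜) (s : 𝕜) :
    star (x + s • y) ⬝ᵥ A *ᵥ (x + s • y) =
      star x ⬝ᵥ A *ᵥ x + s * (star x ⬝ᵥ A *ᵥ y) + star s * (star y ⬝ᵥ A *ᵥ x) + star s * s * (star y ⬝ᵥ A *ᵥ y) := by
  simp only [star_add, star_smul, mulVec_add, mulVec_smul, add_dotProduct, dotProduct_add, smul_dotProduct,
    dotProduct_smul, smul_eq_mul]
  ring

/-- For a hermitian `A`: `conj (x^*Ay) = y^*Ax`. [cite: HornJohnson2013, §4.1 (p. 226)] -/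
theorem star_form_of_isHermitian {A : Matrix n n 𝕜} (hA : A.IsHermitian) (x y : n → 𝕜) :
    star (star x ⬝ᵥ A *ᵥ y) = star y ⬝ᵥ A *ᵥ x := by
  rw [← star_dotProduct_star, star_star, star_mulVec, hA.eq, ← dotProduct_mulVec]

/-- If `Y v = x • v` then `v^*(A Y)v = x · v^*Av`. [cite: HornJohnson2013, §4.1 (p. 226)] -/
theorem form_mul_of_mulVec_eq_smul (A Y : Matrix n n 𝕜) {v : n → 𝕜} {x : 𝕜} (h : Y *ᵥ v = x • v) :
    star v ⬝ᵥ (A * Y) *ᵥ v = x * (star v ⬝ᵥ A *ᵥ v) := by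
  rw [← mulVec_mulVec, h, mulVec_smul, dotProduct_smul, smul_eq_mul]

/-- Conjugating everything: `(ū)^* Ā ū = conj (u^*Au)` for the entrywise conjugate matrix `Ā = A.map conj`.
[cite: HornJohnson2013, §4.1 (p. 226)] -/
theorem form_map_starRingEnd (A : Matrix n n 𝕜) (u : n → 𝕜) :
    star (star u) ⬝ᵥ (A.map (starRingEnd 𝕜)) *ᵥ (star u) = starRingEnd 𝕜 (star u ⬝ᵥ A *ᵥ u) := by
  simp only [dotProduct, mulVec, Matrix.map_apply, Pi.star_apply, RCLike.star_def, map_sum, map_mul,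
    RingHomCompTriple.comp_apply, RingHom.id_apply]

/-- Real parts agree after conjugating everything: `re ((ū)^* Ā ū) = re (u^*Au)`. [cite: HornJohnson2013, §4.1 (p. 226)] -/
theorem re_form_map_starRingEnd (A : Matrix n n 𝕜) (u : n → 𝕜) :
    RCLike.re (star (star u) ⬝ᵥ (A.map (starRingEnd 𝕜)) *ᵥ (star u)) = RCLike.re (star u ⬝ᵥ A *ᵥ u) := by
  rw [form_map_starRingEnd, RCLike.conj_re]

/-! ## §2 A value of each sign forces an eigenvalue of each sign -/

variable [DecidableEq n] {A : Matrix n n 𝕜}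

/-- «at least one eigenvalue in `[α, ∞)`»: if `u^*Au > 0` for some `u` then `A` has a positive eigenvalue.
[cite: HornJohnson2013, §4.2 exercise after Thm. 4.2.2 (p. 304)] -/
theorem exists_eigenvalues_pos_of_re_form_pos (hA : A.IsHermitian) {u : n → 𝕜} (hu : 0 < RCLike.re (star u ⬝ᵥ A *ᵥ u)) :
    ∃ i, 0 < hA.eigenvalues i := by
  rcases isEmpty_or_nonempty n with hn | hn
  · have : star u ⬝ᵥ A *ᵥ u = 0 := by simp [dotProduct]
    rw [this, map_zero] at hu
    exact absurd hu (lt_irrefl _)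
  have h := RayleighQuotient.re_form_le_sup_mul hA u
  have hlt : 0 < univ.sup' univ_nonempty hA.eigenvalues * ∑ i, ‖u i‖ ^ 2 := hu.trans_le h
  have hsum : 0 ≤ ∑ i, ‖u i‖ ^ 2 := sum_nonneg fun i _ => sq_nonneg _
  have hsup : 0 < univ.sup' univ_nonempty hA.eigenvalues := by
    by_contra hle
    exact absurd hlt (not_lt.mpr (mul_nonpos_iff.mpr (Or.inr ⟨not_lt.mp hle, hsum⟩)))
  obtain ⟨i, -, hi⟩ := (Finset.lt_sup'_iff _).mp hsup
  exact ⟨i, hi⟩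

/-- «at least one eigenvalue in `(−∞, α]`»: if `w^*Aw < 0` for some `w` then `A` has a negative eigenvalue.
[cite: HornJohnson2013, §4.2 exercise after Thm. 4.2.2 (p. 304)] -/
theorem exists_eigenvalues_neg_of_re_form_neg (hA : A.IsHermitian) {w : n → 𝕜} (hw : RCLike.re (star w ⬝ᵥ A *ᵥ w) < 0) :
    ∃ i, hA.eigenvalues i < 0 := by
  rcases isEmpty_or_nonempty n with hn | hn
  · have : star w ⬝ᵥ A *ᵥ w = 0 := by simp [dotProduct]
    rw [this, map_zero] at hw
    exact absurd hw (lt_irrefl _)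
  have h := RayleighQuotient.inf_mul_le_re_form hA w
  have hlt : univ.inf' univ_nonempty hA.eigenvalues * ∑ i, ‖w i‖ ^ 2 < 0 := h.trans_lt hw
  have hsum : 0 ≤ ∑ i, ‖w i‖ ^ 2 := sum_nonneg fun i _ => sq_nonneg _
  have hinf : univ.inf' univ_nonempty hA.eigenvalues < 0 := by
    by_contra hle
    exact absurd hlt (not_lt.mpr (mul_nonneg (not_lt.mp hle) hsum))
  obtain ⟨i, -, hi⟩ := (Finset.inf'_lt_iff _).mp hinf
  exact ⟨i, hi⟩

/-- Counting form: a positive value of the form gives at least one positive eigenvalue.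
[cite: HornJohnson2013, §4.2 exercise after Thm. 4.2.2 (p. 304)] -/
theorem one_le_card_eigenvalues_pos (hA : A.IsHermitian) {u : n → 𝕜} (hu : 0 < RCLike.re (star u ⬝ᵥ A *ᵥ u)) :
    1 ≤ (univ.filter fun i => 0 < hA.eigenvalues i).card := by
  obtain ⟨i, hi⟩ := exists_eigenvalues_pos_of_re_form_pos hA hu
  exact Finset.card_pos.mpr ⟨i, Finset.mem_filter.mpr ⟨Finset.mem_univ i, hi⟩⟩

/-- Counting form: a negative value of the form leaves at most `n − 1` positive eigenvalues.
[cite: HornJohnson2013, §4.2 exercise after Thm. 4.2.2 (p. 304)] -/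
theorem card_eigenvalues_pos_add_one_le (hA : A.IsHermitian) {w : n → 𝕜} (hw : RCLike.re (star w ⬝ᵥ A *ᵥ w) < 0) :
    (univ.filter fun i => 0 < hA.eigenvalues i).card + 1 ≤ Fintype.card n := by
  obtain ⟨j, hj⟩ := exists_eigenvalues_neg_of_re_form_neg hA hw
  have hsub : (univ.filter fun i => 0 < hA.eigenvalues i) ⊆ univ.erase j := by
    intro i hi
    rw [Finset.mem_filter] at hi
    refine Finset.mem_erase.mpr ⟨?_, Finset.mem_univ i⟩
    rintro rfl
    exact absurd (hi.2.trans hj) (lt_irrefl _)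
  have h := Finset.card_le_card hsub
  rw [Finset.card_erase_of_mem (Finset.mem_univ j), Finset.card_univ] at h
  have hpos : 0 < Fintype.card n := Fintype.card_pos_iff.mpr ⟨j⟩
  omega

/-- **`3 × 3`: indefinite ⇒ `1` or `2` positive eigenvalues.**  If a hermitian `3 × 3` matrix takes a positive value at some
vector and a negative value at another, the number of its positive eigenvalues (Mathlib's `IsHermitian.eigenvalues`, counted on
`Fin 3`) is `1` or `2` — the «balanced signature» condition of Landherr-type arguments.
[cite: HornJohnson2013, §4.2 exercise after Thm. 4.2.2 (p. 304)] -/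
theorem card_eigenvalues_pos_eq_one_or_two {A : Matrix (Fin 3) (Fin 3) 𝕜} (hA : A.IsHermitian) {u w : Fin 3 → 𝕜}
    (hu : 0 < RCLike.re (star u ⬝ᵥ A *ᵥ u)) (hw : RCLike.re (star w ⬝ᵥ A *ᵥ w) < 0) :
    (univ.filter fun i => 0 < hA.eigenvalues i).card = 1 ∨ (univ.filter fun i => 0 < hA.eigenvalues i).card = 2 := by
  have h1 := one_le_card_eigenvalues_pos hA hu
  have h2 := card_eigenvalues_pos_add_one_le hA hw
  rw [Fintype.card_fin] at h2
  omega

/-! ## §3 A non-degenerate form with an isotropic vector takes both signs -/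

omit [DecidableEq n] in
/-- A non-degenerate form pairs every non-zero `v` non-trivially with some vector: `v^*Aw ≠ 0`.
[cite: HornJohnson2013, §4.1 (p. 226)] -/
theorem exists_form_ne_zero_of_det_ne_zero [DecidableEq n] (hdet : A.det ≠ 0) {v : n → 𝕜} (hv : v ≠ 0) :
    ∃ w : n → 𝕜, star v ⬝ᵥ A *ᵥ w ≠ 0 := by
  by_contra hall
  push Not at hall
  have h1 : star v ᵥ* A = 0 := by
    funext j
    have := hall (Pi.single j 1)
    rwa [dotProduct_mulVec, dotProduct_single, mul_one] at this
  exact hv (star_eq_zero.mp (Matrix.eq_zero_of_vecMul_eq_zero hdet h1))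

omit [DecidableEq n] in
/-- **Isotropic vector ⇒ both signs.**  If `A` is hermitian with `det A ≠ 0` and `v ≠ 0` is isotropic (`v^*Av = 0`), then
`u^*Au > 0` for some `u` and `w^*Aw < 0` for some `w` (`u, w = v ± r w₁` with `v^*Aw₁ = 1`, `r` real small).
[cite: HornJohnson2013, §4.1 (p. 226)] -/
theorem exists_re_form_pos_and_neg_of_isotropic [DecidableEq n] (hA : A.IsHermitian) (hdet : A.det ≠ 0) {v : n → 𝕜}
    (hv : v ≠ 0) (h0 : star v ⬝ᵥ A *ᵥ v = 0) :
    (∃ u : n → 𝕜, 0 < RCLike.re (star u ⬝ᵥ A *ᵥ u)) ∧ ∃ w : n → 𝕜, RCLike.re (star w ⬝ᵥ A *ᵥ w) < 0 := by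
  obtain ⟨w₀, hw₀⟩ := exists_form_ne_zero_of_det_ne_zero hdet hv
  set z : 𝕜 := star v ⬝ᵥ A *ᵥ w₀ with hz
  set w₁ : n → 𝕜 := z⁻¹ • w₀ with hw₁
  have h1 : star v ⬝ᵥ A *ᵥ w₁ = 1 := by
    rw [hw₁, mulVec_smul, dotProduct_smul, smul_eq_mul, ← hz, inv_mul_cancel₀ hw₀]
  have h1' : star w₁ ⬝ᵥ A *ᵥ v = 1 := by rw [← star_form_of_isHermitian hA, h1, star_one]
  set c : 𝕜 := star w₁ ⬝ᵥ A *ᵥ w₁ with hc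
  -- the form along `v + r w₁`, `r` real: `2r + r² c`
  have hq : ∀ r : ℝ, RCLike.re (star (v + (r : 𝕜) • w₁) ⬝ᵥ A *ᵥ (v + (r : 𝕜) • w₁)) = 2 * r + r ^ 2 * RCLike.re c := by
    intro r
    rw [form_add_smul, h0, h1, h1', ← hc, RCLike.star_def, RCLike.conj_ofReal]
    have h2 : (0 : 𝕜) + (r : 𝕜) * 1 + (r : 𝕜) * 1 + (r : 𝕜) * (r : 𝕜) * c = ((2 * r : ℝ) : 𝕜) + ((r ^ 2 : ℝ) : 𝕜) * c := by
      push_cast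
      ring
    rw [h2, map_add, RCLike.ofReal_re, RCLike.re_ofReal_mul]
  set t : ℝ := 1 / (1 + |RCLike.re c|) with ht
  have ht0 : 0 < t := by rw [ht]; positivity
  have ht1 : t * |RCLike.re c| < 1 := by
    rw [ht, one_div, inv_mul_lt_iff₀ (by positivity)]
    linarith
  refine ⟨⟨v + (t : 𝕜) • w₁, ?_⟩, ⟨v + ((-t : ℝ) : 𝕜) • w₁, ?_⟩⟩
  · rw [hq]
    have h3 : -(t ^ 2 * |RCLike.re c|) ≤ t ^ 2 * RCLike.re c := by
      rw [← mul_neg]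
      exact mul_le_mul_of_nonneg_left (neg_abs_le _) (sq_nonneg t)
    nlinarith
  · rw [hq]
    have h3 : (-t) ^ 2 * RCLike.re c ≤ t ^ 2 * |RCLike.re c| := by
      rw [neg_sq]
      exact mul_le_mul_of_nonneg_left (le_abs_self _) (sq_nonneg t)
    nlinarith

end Literature.LinearAlgebra.Matrix
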